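import Mathlib
import HarnessLib

/-!
# Observed heredity exponent `β_obs = 2 + log g / log λ`: a Kelvin-capped hand-over never reads
# «INSIDE WINDOW» (instab lane, door O-acc = O7, obstruction P3 — `HOME/instab2/HEREDITY-P3.md` (B)/(D);
# SPEC-P-TOWER-2 B2-H «H-ledger» instrument `HOME/tower-read3/hledger/hledger.py`; TRIGGER-CENSUS row T5)

HONEST FRAMING (cell `ns-blowup`, seat `ns-blowup-instab2`; human ruling D-0035): this cell ATTEMPTS the
negative direction of the Clay problem; nothing in this file is a claim about the Navier–Stokes equations.
WHAT THIS IS NOT: not fluid mechanics. Every declaration below is an identity or inequality between REAL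
NUMBERS (`Real.log`, `Real.rpow`); the fluid reading of each symbol is fixed by the dictionary below and
argued in prose in `HEREDITY-P3.md` (B) and SPEC-P-TOWER-2 §B2-H. The file exists so that the census words
of TRIGGER-CENSUS T5 / the H-ledger — «KELVIN-CAPPED» and «INSIDE WINDOW can only arise by merger or by flux
drawn from the still-forced host» — carry kernel names and NUMBERS.

## Dictionary (SPEC-P-TOWER-2 v0.9 §B2-H; Palasek arXiv:2605.13827 §3 rescaling `ν = 1`)

* A level-`k` PARENT structure has core radius `r_P > 0` and circulation `Γ_P > 0`; a candidate
  level-`(k+1)` DAUGHTER has `r_D > 0`, `Γ_D > 0`. SCALE RATIO `λ := r_P / r_D` (a hand-over to a FINER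
  level means `λ > 1`; the census scale floor is `λ ≥ 2`); CIRCULATION GAIN `g := Γ_D / Γ_P > 0`.
* Palasek's dictionary `A_j = N_j^β`, `r_j = N_j⁻¹` gives `Γ_j ≍ A_j r_j² = N_j^{β-2}`, hence `g = λ^{β-2}`
  along the tower; the instrument INVERTS this: `β_obs := 2 + log g / log λ` (hledger `beta_obs`).
* KELVIN CEILING (Barrier `Literature/Barriers/NavierStokesRegularity/PalasekTowerKelvinCeiling.lean`,
  RATE-AUDIT R8 UPHELD; «PRICE, NOT KILL» ledger `HeredityConstantLedger.amount_factor_le_one`): an UNFORCED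
  daughter drawn from ONE parent's material has `Γ_D ≤ Γ_P`, i.e. `g ≤ 1`.
* WINDOW of record for the exponent: `β ∈ [11/5, 49/20] = [2.2, 2.45]` (SPEC-2 K3-7: `[2.2, 1+√2)` is
  Palasek-admissible, DC4 cuts at `2.45`; `(2.414, 2.45]` is annotated «inside Palasek (3.2), above DC4»).

## What is proved (hypotheses `1 < λ`, `0 < g` unless weaker ones suffice)

§1 SIGN AND MONOTONICITY: `β_obs ≤ 2 ↔ g ≤ 1`, `β_obs < 2 ↔ g < 1`, `β_obs = 2 ↔ g = 1`; `β_obs` is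
monotone in `g`; the INVERSION `β_obs = β ↔ g = λ^(β-2)` and `β_obs(λ^(β-2)) = β`.
§2 WINDOW CONSEQUENCES: `2 + δ ≤ β_obs ↔ λ^δ ≤ g` and `β_obs ≤ 2 + δ ↔ g ≤ λ^δ`; hence INSIDE WINDOW
`⇒ λ^{1/5} ≤ g` with `λ^{1/5} > 1` — a circulation GAIN —, and a Kelvin-capped daughter (`g ≤ 1`) reads
`β_obs ≤ 2 < 11/5`: NEVER inside the window (the registered prior «KELVIN-CAPPED wherever H-a fires»).
MERGER: a daughter fed by `n` parents of circulation `≤ Γ_P` each has `g ≤ n` against one of them, so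
`β_obs ≤ 2 + log n / log λ`.
§3 NUMBERS: at the scale floor `λ = 2` the window is `g ∈ [2^{1/5}, 2^{9/20}]` with
`1.148 < 2^{1/5} < 1.149` and `1.366 < 2^{9/20} < 1.367`; two parents merging completely at `λ = 2`
read `β_obs = 3` and at `λ = 4` read `β_obs = 5/2` — both ABOVE `49/20`. Mathlib only; no definitions.
LABEL: MODEL-door bookkeeping (an instrument's arithmetic).
-/

namespace Summit.NavierStokesRegularity.FluidComputer.HeredityObservedExponent

open Real

section Sign

/-! ## §1 Sign, monotonicity and inversion of `β_obs = 2 + log g / log λ` -/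

/-- `β_obs ≤ 2 ↔ g ≤ 1` (`λ > 1`, `g > 0`): the observed exponent sits at or below the Kelvin-neutral
value `2` exactly when the daughter carries no more circulation than the parent. -/
theorem betaObs_le_two_iff {lam g : ℝ} (hlam : 1 < lam) (hg : 0 < g) :
    2 + log g / log lam ≤ 2 ↔ g ≤ 1 := by
  have hl : 0 < log lam := log_pos hlam
  constructor
  · intro h
    have h1 : log g / log lam ≤ 0 := by linarith
    have h2 : log g ≤ 0 := by
      have := div_nonpos_iff.mp h1
      rcases this with ⟨_, hb⟩ | ⟨ha, _⟩
      · exact absurd hb (not_le.mpr hl)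
      · exact ha
    exact (log_nonpos_iff hg.le).mp h2
  · intro h
    have h2 : log g ≤ 0 := (log_nonpos_iff hg.le).mpr h
    have h1 : log g / log lam ≤ 0 := div_nonpos_of_nonpos_of_nonneg h2 hl.le
    linarith

/-- `β_obs < 2 ↔ g < 1` (`λ > 1`, `g > 0`): strict circulation LOSS reads strictly below `2`. -/
theorem betaObs_lt_two_iff {lam g : ℝ} (hlam : 1 < lam) (hg : 0 < g) :
    2 + log g / log lam < 2 ↔ g < 1 := by
  have hl : 0 < log lam := log_pos hlam
  constructor
  · intro h
    have h1 : log g / log lam < 0 := by linarith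
    have h2 : log g < 0 := by
      by_contra hc
      push Not at hc
      have : 0 ≤ log g / log lam := div_nonneg hc hl.le
      linarith
    exact (log_neg_iff hg).mp h2
  · intro h
    have h2 : log g < 0 := (log_neg_iff hg).mpr h
    have h1 : log g / log lam < 0 := div_neg_of_neg_of_pos h2 hl
    linarith

/-- `β_obs = 2 ↔ g = 1` (`λ > 1`, `g > 0`): the Kelvin-NEUTRAL reading is exact circulation transfer. -/
theorem betaObs_eq_two_iff {lam g : ℝ} (hlam : 1 < lam) (hg : 0 < g) :
    2 + log g / log lam = 2 ↔ g = 1 := by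
  have hl : 0 < log lam := log_pos hlam
  constructor
  · intro h
    have h1 : log g / log lam = 0 := by linarith
    have h2 : log g = 0 := by
      rcases div_eq_zero_iff.mp h1 with h3 | h3
      · exact h3
      · exact absurd h3 hl.ne'
    rcases Real.log_eq_zero.mp h2 with h4 | h4 | h4
    · exact absurd h4 hg.ne'
    · exact h4
    · linarith
  · intro h
    subst h
    simp

/-- MONOTONE IN THE GAIN: at fixed `λ > 1`, `g ≤ g'` (`0 < g`) gives `β_obs(g) ≤ β_obs(g')`. -/
theorem betaObs_mono {lam g g' : ℝ} (hlam : 1 < lam) (hg : 0 < g) (hgg' : g ≤ g') :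
    2 + log g / log lam ≤ 2 + log g' / log lam := by
  have hl : 0 < log lam := log_pos hlam
  have h1 : log g ≤ log g' := log_le_log hg hgg'
  have h2 : log g / log lam ≤ log g' / log lam := div_le_div_of_nonneg_right h1 hl.le
  linarith

/-- STRICTLY MONOTONE IN THE GAIN: `g < g'` (`0 < g`) gives `β_obs(g) < β_obs(g')`. -/
theorem betaObs_strictMono {lam g g' : ℝ} (hlam : 1 < lam) (hg : 0 < g) (hgg' : g < g') :
    2 + log g / log lam < 2 + log g' / log lam := by
  have hl : 0 < log lam := log_pos hlam
  have h1 : log g < log g' := log_lt_log hg hgg'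
  have h2 : log g / log lam < log g' / log lam := div_lt_div_of_pos_right h1 hl
  linarith

/-- THE DICTIONARY FORWARD: along Palasek's tower `g = λ^(β-2)` and then `β_obs = β` exactly
(`λ > 1`; any real `β`). -/
theorem betaObs_rpow {lam : ℝ} (hlam : 1 < lam) (β : ℝ) :
    2 + log (lam ^ (β - 2)) / log lam = β := by
  have hl : 0 < log lam := log_pos hlam
  have h0 : 0 < lam := by linarith
  rw [log_rpow h0, mul_div_assoc, div_self hl.ne', mul_one]
  ring

/-- THE INVERSION: `β_obs = β ↔ g = λ^(β-2)` (`λ > 1`, `g > 0`) — the instrument reads the exponent of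
the unique power law through the two points. -/
theorem betaObs_eq_iff {lam g : ℝ} (hlam : 1 < lam) (hg : 0 < g) (β : ℝ) :
    2 + log g / log lam = β ↔ g = lam ^ (β - 2) := by
  have hl : 0 < log lam := log_pos hlam
  have h0 : 0 < lam := by linarith
  constructor
  · intro h
    have h1 : log g / log lam = β - 2 := by linarith
    have h2 : log g = (β - 2) * log lam := by
      field_simp at h1
      linarith
    have h3 : log g = log (lam ^ (β - 2)) := by rw [log_rpow h0]; exact h2
    exact log_injOn_pos (Set.mem_Ioi.mpr hg) (Set.mem_Ioi.mpr (rpow_pos_of_pos h0 _)) h3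
  · intro h
    rw [h]
    exact betaObs_rpow hlam β

end Sign

section Window

/-! ## §2 Window consequences: a lower exponent edge `2 + δ` is a circulation-GAIN floor `λ^δ` -/

/-- LOWER EDGE: `2 + δ ≤ β_obs ↔ λ^δ ≤ g` (`λ > 1`, `g > 0`; any real `δ`). -/
theorem two_add_le_betaObs_iff {lam g : ℝ} (hlam : 1 < lam) (hg : 0 < g) (δ : ℝ) :
    2 + δ ≤ 2 + log g / log lam ↔ lam ^ δ ≤ g := by
  have hl : 0 < log lam := log_pos hlam
  have h0 : 0 < lam := by linarith
  rw [add_le_add_iff_left, le_div_iff₀ hl, ← log_rpow h0,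
    log_le_log_iff (rpow_pos_of_pos h0 _) hg]

/-- UPPER EDGE: `β_obs ≤ 2 + δ ↔ g ≤ λ^δ` (`λ > 1`, `g > 0`; any real `δ`). -/
theorem betaObs_le_two_add_iff {lam g : ℝ} (hlam : 1 < lam) (hg : 0 < g) (δ : ℝ) :
    2 + log g / log lam ≤ 2 + δ ↔ g ≤ lam ^ δ := by
  have hl : 0 < log lam := log_pos hlam
  have h0 : 0 < lam := by linarith
  rw [add_le_add_iff_left, div_le_iff₀ hl, ← log_rpow h0,
    log_le_log_iff hg (rpow_pos_of_pos h0 _)]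

/-- THE GAIN FLOOR EXCEEDS ONE: for `λ > 1` and `δ > 0`, `λ^δ > 1`. -/
theorem one_lt_rpow_of_window {lam δ : ℝ} (hlam : 1 < lam) (hδ : 0 < δ) : 1 < lam ^ δ :=
  one_lt_rpow hlam hδ

/-- INSIDE WINDOW NEEDS A GAIN: if `β_obs ∈ [11/5, 49/20]` (only the lower edge is used) then
`λ^(1/5) ≤ g` and in particular `1 < g` — the daughter carries MORE circulation than the parent
(`λ > 1`, `g > 0`). -/
theorem gain_of_inside_window {lam g : ℝ} (hlam : 1 < lam) (hg : 0 < g)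
    (h : 11 / 5 ≤ 2 + log g / log lam) : lam ^ ((1 : ℝ) / 5) ≤ g ∧ 1 < g := by
  have h1 : 2 + (1 : ℝ) / 5 ≤ 2 + log g / log lam := by norm_num at h ⊢; exact h
  have h2 : lam ^ ((1 : ℝ) / 5) ≤ g := (two_add_le_betaObs_iff hlam hg _).mp h1
  exact ⟨h2, lt_of_lt_of_le (one_lt_rpow hlam (by norm_num)) h2⟩

/-- KELVIN-CAPPED ⇒ NEVER INSIDE WINDOW: `g ≤ 1` gives `β_obs ≤ 2 < 11/5` (`λ > 1`, `g > 0`). This is the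
registered prior of SPEC-2 §B2-H («for an UNFORCED hand-over Kelvin gives g_obs ≤ 1 ⇒ β_obs ≤ 2»). -/
theorem betaObs_lt_window_of_kelvin {lam g : ℝ} (hlam : 1 < lam) (hg : 0 < g) (hk : g ≤ 1) :
    2 + log g / log lam ≤ 2 ∧ 2 + log g / log lam < 11 / 5 := by
  have h1 : 2 + log g / log lam ≤ 2 := (betaObs_le_two_iff hlam hg).mpr hk
  exact ⟨h1, by linarith⟩

/-- Contrapositive bookkeeping: INSIDE WINDOW (lower edge) is incompatible with the Kelvin cap. -/
theorem not_kelvin_of_inside_window {lam g : ℝ} (hlam : 1 < lam) (hg : 0 < g)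
    (h : 11 / 5 ≤ 2 + log g / log lam) : ¬ g ≤ 1 := by
  intro hk
  have := (betaObs_lt_window_of_kelvin hlam hg hk).2
  linarith

/-- MERGER BOUND: a daughter fed by `n ≥ 1` parents, each Kelvin-capped against the reference parent
(`Γ_i ≤ Γ_P`), has `g = (Σ Γ_i)/Γ_P ≤ n`; then `β_obs ≤ 2 + log n / log λ` (`λ > 1`, `g > 0`). Stated
with the gain already bounded: `g ≤ n`. -/
theorem betaObs_le_of_merger {lam g : ℝ} {n : ℕ} (hlam : 1 < lam) (hg : 0 < g) (hgn : g ≤ n) :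
    2 + log g / log lam ≤ 2 + log n / log lam :=
  betaObs_mono hlam hg hgn

/-- The merger gain itself: if `Γ_i ≤ Γ_P` for `i < n` and `Γ_P > 0` then `(Σ_{i<n} Γ_i)/Γ_P ≤ n`. -/
theorem merger_gain_le {ΓP : ℝ} (hP : 0 < ΓP) {n : ℕ} (Γ : ℕ → ℝ) (hΓ : ∀ i < n, Γ i ≤ ΓP) :
    (Finset.sum (Finset.range n) Γ) / ΓP ≤ n := by
  rw [div_le_iff₀ hP]
  have : Finset.sum (Finset.range n) Γ ≤ Finset.sum (Finset.range n) (fun _ => ΓP) :=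
    Finset.sum_le_sum (fun i hi => hΓ i (Finset.mem_range.mp hi))
  simpa [Finset.sum_const, Finset.card_range] using this

/-- COMPLETE MERGER AT GAIN `g = λ` (e.g. two equal parents merging completely at the scale floor
`λ = 2`) reads `β_obs = 2 + log λ / log λ = 3`. -/
theorem betaObs_full_merger_self {lam : ℝ} (hlam : 1 < lam) :
    2 + log lam / log lam = 3 := by
  have hl : 0 < log lam := log_pos hlam
  rw [div_self hl.ne']; norm_num

end Window

section Numbers

/-! ## §3 Numbers at the census scale floor `λ = 2` and at `λ = 4` -/

/-- `(2^{1/5})^5 = 2` and `(2^{9/20})^20 = 2^9`: the rational powers used below are what they say. -/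
theorem rpow_floor_pows :
    ((2 : ℝ) ^ ((1 : ℝ) / 5)) ^ (5 : ℕ) = 2 ∧ ((2 : ℝ) ^ ((9 : ℝ) / 20)) ^ (20 : ℕ) = 2 ^ (9 : ℕ) := by
  constructor
  · rw [← rpow_natCast, ← rpow_mul (by norm_num : (0 : ℝ) ≤ 2)]
    norm_num
  · rw [← rpow_natCast, ← rpow_mul (by norm_num : (0 : ℝ) ≤ 2)]
    norm_num

/-- WINDOW LOWER EDGE AT `λ = 2`: `1.148 < 2^{1/5} < 1.149` (so INSIDE WINDOW at the scale floor needs a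
circulation gain of at least `14.8 %`). -/
theorem two_rpow_fifth_bounds : (1.148 : ℝ) < (2 : ℝ) ^ ((1 : ℝ) / 5) ∧ (2 : ℝ) ^ ((1 : ℝ) / 5) < 1.149 := by
  have hpos : 0 ≤ (2 : ℝ) ^ ((1 : ℝ) / 5) := rpow_nonneg (by norm_num) _
  have h5 : ((2 : ℝ) ^ ((1 : ℝ) / 5)) ^ (5 : ℕ) = 2 := rpow_floor_pows.1
  constructor
  · by_contra hc
    push Not at hc
    have : ((2 : ℝ) ^ ((1 : ℝ) / 5)) ^ (5 : ℕ) ≤ (1.148 : ℝ) ^ (5 : ℕ) :=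
      pow_le_pow_left₀ hpos hc 5
    rw [h5] at this
    norm_num at this
  · by_contra hc
    push Not at hc
    have : (1.149 : ℝ) ^ (5 : ℕ) ≤ ((2 : ℝ) ^ ((1 : ℝ) / 5)) ^ (5 : ℕ) :=
      pow_le_pow_left₀ (by norm_num) hc 5
    rw [h5] at this
    norm_num at this

/-- WINDOW UPPER EDGE AT `λ = 2`: `1.366 < 2^{9/20} < 1.367`. -/
theorem two_rpow_nine_twentieths_bounds :
    (1.366 : ℝ) < (2 : ℝ) ^ ((9 : ℝ) / 20) ∧ (2 : ℝ) ^ ((9 : ℝ) / 20) < 1.367 := by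
  have hpos : 0 ≤ (2 : ℝ) ^ ((9 : ℝ) / 20) := rpow_nonneg (by norm_num) _
  have h20 : ((2 : ℝ) ^ ((9 : ℝ) / 20)) ^ (20 : ℕ) = 2 ^ (9 : ℕ) := rpow_floor_pows.2
  constructor
  · by_contra hc
    push Not at hc
    have : ((2 : ℝ) ^ ((9 : ℝ) / 20)) ^ (20 : ℕ) ≤ (1.366 : ℝ) ^ (20 : ℕ) :=
      pow_le_pow_left₀ hpos hc 20
    rw [h20] at this
    norm_num at this
  · by_contra hc
    push Not at hc
    have : (1.367 : ℝ) ^ (20 : ℕ) ≤ ((2 : ℝ) ^ ((9 : ℝ) / 20)) ^ (20 : ℕ) :=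
      pow_le_pow_left₀ (by norm_num) hc 20
    rw [h20] at this
    norm_num at this

/-- THE `g`-WINDOW AT THE SCALE FLOOR: for `λ = 2`, `β_obs ∈ [11/5, 49/20] ↔ g ∈ [2^{1/5}, 2^{9/20}]`
(`g > 0`). -/
theorem window_at_two_iff {g : ℝ} (hg : 0 < g) :
    (11 / 5 ≤ 2 + log g / log 2 ∧ 2 + log g / log 2 ≤ 49 / 20) ↔
      ((2 : ℝ) ^ ((1 : ℝ) / 5) ≤ g ∧ g ≤ (2 : ℝ) ^ ((9 : ℝ) / 20)) := by
  have h2 : (1 : ℝ) < 2 := by norm_num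
  have hlo := two_add_le_betaObs_iff h2 hg ((1 : ℝ) / 5)
  have hhi := betaObs_le_two_add_iff h2 hg ((9 : ℝ) / 20)
  constructor
  · rintro ⟨ha, hb⟩
    refine ⟨hlo.mp ?_, hhi.mp ?_⟩
    · norm_num at ha ⊢; exact ha
    · norm_num at hb ⊢; exact hb
  · rintro ⟨ha, hb⟩
    have ha' := hlo.mpr ha
    have hb' := hhi.mpr hb
    constructor
    · norm_num at ha' ⊢; exact ha'
    · norm_num at hb' ⊢; exact hb'

/-- TWO PARENTS MERGING COMPLETELY AT THE SCALE FLOOR read `β_obs = 3 > 49/20`: ABOVE the window. -/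
theorem two_parents_at_floor : 2 + log (2 : ℝ) / log 2 = 3 ∧ (49 : ℝ) / 20 < 3 := by
  refine ⟨betaObs_full_merger_self (by norm_num : (1 : ℝ) < 2), by norm_num⟩

/-- TWO PARENTS MERGING COMPLETELY AT `λ = 4` read `β_obs = 5/2 > 49/20`: still ABOVE the window
(`log 4 = 2 log 2`). -/
theorem two_parents_at_four : 2 + log (2 : ℝ) / log 4 = 5 / 2 ∧ (49 : ℝ) / 20 < 5 / 2 := by
  have hl2 : 0 < log (2 : ℝ) := log_pos (by norm_num)
  have h4 : log (4 : ℝ) = 2 * log 2 := by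
    rw [show (4 : ℝ) = 2 ^ (2 : ℕ) by norm_num, log_pow]; norm_num
  constructor
  · rw [h4]; field_simp; ring
  · norm_num

/-- AT `λ = 4` the window's gain interval sits inside `(1.31, 1.87)`: `4^{1/5} > 1.31` and `4^{9/20} < 1.87`
(so at a factor-4 hand-over «INSIDE WINDOW» means a `31 %`–`87 %` circulation GAIN). -/
theorem window_at_four_bounds :
    (1.31 : ℝ) < (4 : ℝ) ^ ((1 : ℝ) / 5) ∧ (4 : ℝ) ^ ((9 : ℝ) / 20) < 1.87 := by
  have hpos1 : 0 ≤ (4 : ℝ) ^ ((1 : ℝ) / 5) := rpow_nonneg (by norm_num) _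
  have h5 : ((4 : ℝ) ^ ((1 : ℝ) / 5)) ^ (5 : ℕ) = 4 := by
    rw [← rpow_natCast, ← rpow_mul (by norm_num : (0 : ℝ) ≤ 4)]; norm_num
  have h20 : ((4 : ℝ) ^ ((9 : ℝ) / 20)) ^ (20 : ℕ) = 4 ^ (9 : ℕ) := by
    rw [← rpow_natCast, ← rpow_mul (by norm_num : (0 : ℝ) ≤ 4)]; norm_num
  constructor
  · by_contra hc
    push Not at hc
    have : ((4 : ℝ) ^ ((1 : ℝ) / 5)) ^ (5 : ℕ) ≤ (1.31 : ℝ) ^ (5 : ℕ) := pow_le_pow_left₀ hpos1 hc 5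
    rw [h5] at this
    norm_num at this
  · by_contra hc
    push Not at hc
    have : (1.87 : ℝ) ^ (20 : ℕ) ≤ ((4 : ℝ) ^ ((9 : ℝ) / 20)) ^ (20 : ℕ) :=
      pow_le_pow_left₀ (by norm_num) hc 20
    rw [h20] at this
    norm_num at this

end Numbers

end Summit.NavierStokesRegularity.FluidComputer.HeredityObservedExponent
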